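import Literature.NumberTheory.LFunctions.SuzukiSingleOperatorKernelProofs

/-!
# SuzukiWindowsDoorArchKernel — the archimedean symbol `Θ_θ^arch` and kernel `g_θ` of Suzuki's single operator (column DBR; RH-FREE)

RH-FREE throughout; nothing here bears on the truth of RH.  First of three files proving the column's
PROOF-OF-DATA target `LimKernelWindowIdentity` — the series representation [Su20] (1.12)
`K_θ(x) = Σ_{n ≤ e^x} λ_θ(n) n^{-1/2} g_θ(x − log n)` of Suzuki's single-operator kernel (M. Suzuki, ASPM 84 (2020)
= arXiv:1907.07302, §1 (1.10)–(1.12), §3), which is the formula BOTH engine lineages of the DBR column use to compute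
`K_θ` (DATA/code/et1c, et1e, et1f), whereas the tree's `limKernel θ` is defined SPECTRALLY (inverse Fourier transform of
`Θ_θ` along `Im z = 1`).  This file treats the archimedean constituent:

* §1 the factorisation `Θ_θ(z) = Θ_θ^arch(z) · exp(2θ Σ Λ(n) n^{-s})`, `s = ½ − iz`, `Im z > ½`
  (`ξ = γ·ζ` near `s`, `ζ'/ζ = −Σ Λ(n)n^{-s}`);
* §2 uniform decay `‖Θ_θ^arch(u + ib)‖ ≤ C (1 + |u|)^{−θ}` for `b ≥ b₀ > ½` (from the tree's decay of `Θ_θ` and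
  `|exp(−2θ Σ Λ n^{-s})| ≤ exp(2θ Σ Λ n^{-σ₀})`);
* §3 holomorphy of `Θ_θ^arch` on `Im z > ½`, integrability on the lines, LINE INDEPENDENCE of
  `invFourierLine Θ_θ^arch b x` in `b > ½` (the tree's generic strip lemma `integral_line_eq_of_differentiableOn_strip`),
  the growth bound `‖invFourierLine Θ_θ^arch b x‖ ≤ D e^{bx}`;
* §4 `g_θ = 0` on `(−∞, 0)` ([Su20] §3: «g_θ vanishes on the negative half-line», `b → ∞`) and continuity of `g_θ`.

References: [Su20] M. Suzuki, ASPM 84 (2020) 399–411 = arXiv:1907.07302, §1 (1.11), §3.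
-/

noncomputable section

-- D-0017: `Summit.<S>.<S>.…` is the designed namespace of a single-problem summit.
set_option linter.dupNamespace false

open MeasureTheory Set Filter Topology Complex

namespace Summit.RiemannHypothesis.RiemannHypothesis.Theorems.SuzukiWindowsDoorArchKernel

open Literature.NumberTheory.LFunctions
open LSeries
open scoped LSeries.notation ArithmeticFunction.vonMangoldt

/-! ## §1 The factorisation `Θ_θ = Θ_θ^arch · exp(2θ Σ Λ(n) n^{-s})` on `Im z > ½` -/

/-- RH-FREE.  `γ(s) = ½ s(s−1) Γ_ℝ(s) ≠ 0` for `Re s > 0`, `s ≠ 1`. -/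
theorem xiGammaFactor_ne_zero {s : ℂ} (hs : 0 < s.re) (hs1 : s ≠ 1) : xiGammaFactor s ≠ 0 := by
  have hs0 : s ≠ 0 := fun h => by simp [h] at hs
  unfold xiGammaFactor
  exact mul_ne_zero (div_ne_zero (mul_ne_zero hs0 (sub_ne_zero.2 hs1)) two_ne_zero)
    (Gammaℝ_ne_zero_of_re_pos hs)

/-- RH-FREE.  On the open half-plane `Re s > 1`, `ξ = γ · ζ` identically (so near every such `s`). -/
theorem riemannXi_eventuallyEq_mul {s : ℂ} (hs : 1 < s.re) :
    riemannXi =ᶠ[𝓝 s] fun z => xiGammaFactor z * riemannZeta z := by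
  filter_upwards [(isOpen_lt continuous_const Complex.continuous_re).mem_nhds hs] with z hz
  have hz' : 1 < z.re := hz
  have hz1 : z ≠ 1 := fun h => by rw [h] at hz'; simp at hz'
  exact (xiGammaFactor_mul_riemannZeta hz1 (Gammaℝ_ne_zero_of_re_pos (by linarith))).symm

/-- RH-FREE.  **`ξ'/ξ = γ'/γ − Σ Λ(n) n^{-s}` on `Re s > 1`** (`ξ = γζ`, `ζ'/ζ = −Σ Λ(n)n^{-s}`). -/
theorem logDeriv_riemannXi_eq_arch_sub {s : ℂ} (hs : 1 < s.re) :
    deriv riemannXi s / riemannXi s = deriv xiGammaFactor s / xiGammaFactor s - L ↗Λ s := by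
  have hs0 : 0 < s.re := by linarith
  have hs1 : s ≠ 1 := fun h => by rw [h] at hs; simp at hs
  have hγ : xiGammaFactor s ≠ 0 := xiGammaFactor_ne_zero hs0 hs1
  have hζ : riemannZeta s ≠ 0 := riemannZeta_ne_zero_of_one_le_re hs.le
  have hdγ : DifferentiableAt ℂ xiGammaFactor s := differentiableAt_xiGammaFactor (Or.inl hs0)
  have hdζ : DifferentiableAt ℂ riemannZeta s := differentiableAt_riemannZeta hs1
  have hev := riemannXi_eventuallyEq_mul hs
  rw [hev.deriv_eq, hev.eq_of_nhds, deriv_fun_mul hdγ hdζ,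
    ArithmeticFunction.LSeries_vonMangoldt_eq_deriv_riemannZeta_div hs]
  field_simp
  ring

/-- `Re(½ − iz) = ½ + Im z`. -/
theorem re_half_sub_I_mul (z : ℂ) : ((1 : ℂ) / 2 - I * z).re = 1 / 2 + z.im := by
  simp [Complex.mul_re]

/-- RH-FREE.  **Factorisation of Suzuki's symbol** into its archimedean and prime parts on `Im z > ½`:
`Θ_θ(z) = Θ_θ^arch(z) · exp(2θ Σ Λ(n) n^{-(½ − iz)})` ([Su20] (1.10)–(1.11): `exp(−2θξ'/ξ) = exp(−2θγ'/γ)·exp(−2θζ'/ζ)`). -/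
theorem limTheta_eq_limThetaArch_mul (θ : ℝ) {z : ℂ} (hz : 1 / 2 < z.im) :
    limTheta θ z = limThetaArch θ z * Complex.exp (2 * θ * L ↗Λ (1 / 2 - I * z)) := by
  have hs : 1 < ((1 : ℂ) / 2 - I * z).re := by rw [re_half_sub_I_mul]; linarith
  unfold limTheta limThetaArch
  rw [← Complex.exp_add, logDeriv_riemannXi_eq_arch_sub hs]
  congr 1
  ring

/-- RH-FREE.  The same factorisation solved for the archimedean symbol:
`Θ_θ^arch(z) = Θ_θ(z) · exp(−2θ Σ Λ(n) n^{-(½ − iz)})`. -/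
theorem limThetaArch_eq_limTheta_mul (θ : ℝ) {z : ℂ} (hz : 1 / 2 < z.im) :
    limThetaArch θ z = limTheta θ z * Complex.exp (-(2 * θ * L ↗Λ (1 / 2 - I * z))) := by
  rw [limTheta_eq_limThetaArch_mul θ hz, mul_assoc, ← Complex.exp_add, add_neg_cancel, Complex.exp_zero,
    mul_one]

/-! ## §2 Uniform decay of `Θ_θ^arch` on the lines `Im z = b ≥ b₀ > ½` -/

/-- `|Σ Λ(n) n^{-s}| ≤ Σ Λ(n) n^{-σ₀}` for `Re s ≥ σ₀ > 1` (termwise). -/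
theorem norm_LSeries_vonMangoldt_le_of_le_re {σ₀ : ℝ} (hσ₀ : 1 < σ₀) {s : ℂ} (hs : σ₀ ≤ s.re) :
    ‖L ↗Λ s‖ ≤ ∑' n : ℕ, ‖term ↗Λ (σ₀ : ℂ) n‖ := by
  have hsum0 : Summable fun n ↦ ‖term ↗Λ (σ₀ : ℂ) n‖ := by
    have h := ArithmeticFunction.LSeriesSummable_vonMangoldt (s := (σ₀ : ℂ)) (by simpa using hσ₀)
    exact summable_norm_iff.mpr h
  have hle : ∀ n, ‖term ↗Λ s n‖ ≤ ‖term ↗Λ (σ₀ : ℂ) n‖ := fun n ↦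
    norm_term_le_of_re_le_re _ (by simpa using hs) n
  have hsum : Summable fun n ↦ ‖term ↗Λ s n‖ :=
    Summable.of_nonneg_of_le (fun _ ↦ norm_nonneg _) hle hsum0
  calc ‖L ↗Λ s‖ = ‖∑' n, term ↗Λ s n‖ := rfl
    _ ≤ ∑' n, ‖term ↗Λ s n‖ := norm_tsum_le_tsum_norm hsum
    _ ≤ ∑' n, ‖term ↗Λ (σ₀ : ℂ) n‖ := hsum.tsum_le_tsum hle hsum0

/-- `‖exp(−2θ Σ Λ(n) n^{-s})‖ ≤ exp(2θ Σ Λ(n) n^{-σ₀})` for `θ ≥ 0`, `Re s ≥ σ₀ > 1`. -/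
theorem norm_cexp_neg_two_mul_LSeries_le {θ σ₀ : ℝ} (hθ : 0 ≤ θ) (hσ₀ : 1 < σ₀) {s : ℂ} (hs : σ₀ ≤ s.re) :
    ‖Complex.exp (-(2 * θ * L ↗Λ s))‖ ≤ Real.exp (2 * θ * ∑' n : ℕ, ‖term ↗Λ (σ₀ : ℂ) n‖) := by
  rw [Complex.norm_exp, Real.exp_le_exp, Complex.neg_re]
  have h1 : (2 * (θ : ℂ) * L ↗Λ s).re = 2 * θ * (L ↗Λ s).re := by
    have : (2 * (θ : ℂ)) = ((2 * θ : ℝ) : ℂ) := by push_cast; ring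
    rw [this, Complex.re_ofReal_mul]
  rw [h1]
  have h2 : -(L ↗Λ s).re ≤ ∑' n : ℕ, ‖term ↗Λ (σ₀ : ℂ) n‖ :=
    (neg_le_abs _).trans ((Complex.abs_re_le_norm _).trans (norm_LSeries_vonMangoldt_le_of_le_re hσ₀ hs))
  nlinarith

/-- **Uniform decay of the archimedean symbol** (RH-free): for `θ ≥ 0` and `b₀ > ½` there is `C > 0` with
`‖Θ_θ^arch(u + ib)‖ ≤ C (1 + |u|)^{−θ}` for all `b ≥ b₀` and all real `u` (tree: `norm_limTheta_line_le` for `Θ_θ`,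
times the bound of `exp(−2θ Σ Λ n^{-s})` on `Re s ≥ ½ + b₀`).  [Su20] §3: `exp(−2θγ'/γ(s)) ≍ |s|^{−θ}` by Stirling. -/
theorem norm_limThetaArch_line_le {θ b₀ : ℝ} (hθ : 0 ≤ θ) (hb₀ : 1 / 2 < b₀) :
    ∃ C : ℝ, 0 < C ∧ ∀ b : ℝ, b₀ ≤ b → ∀ u : ℝ,
      ‖limThetaArch θ ((u : ℂ) + (b : ℂ) * I)‖ ≤ C * (1 + |u|) ^ (-θ) := by
  obtain ⟨C, hC0, hC⟩ := norm_limTheta_line_le hθ hb₀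
  set σ₀ : ℝ := 1 / 2 + b₀ with hσ₀def
  have hσ₀ : 1 < σ₀ := by rw [hσ₀def]; linarith
  set Z : ℝ := ∑' n : ℕ, ‖term ↗Λ (σ₀ : ℂ) n‖ with hZ
  refine ⟨C * Real.exp (2 * θ * Z), by positivity, fun b hb u => ?_⟩
  set z : ℂ := (u : ℂ) + (b : ℂ) * I with hzdef
  have hzim : z.im = b := by simp [hzdef]
  have hz : 1 / 2 < z.im := by rw [hzim]; linarith
  have hsre : σ₀ ≤ ((1 : ℂ) / 2 - I * z).re := by rw [re_half_sub_I_mul, hzim, hσ₀def]; linarith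
  rw [limThetaArch_eq_limTheta_mul θ hz, norm_mul]
  calc ‖limTheta θ z‖ * ‖Complex.exp (-(2 * θ * L ↗Λ (1 / 2 - I * z)))‖
      ≤ C * (1 + |u|) ^ (-θ) * Real.exp (2 * θ * Z) :=
        mul_le_mul (hC b hb u) (norm_cexp_neg_two_mul_LSeries_le hθ hσ₀ hsre) (norm_nonneg _)
          (by positivity)
    _ = C * Real.exp (2 * θ * Z) * (1 + |u|) ^ (-θ) := by ring

/-! ## §3 Holomorphy of `Θ_θ^arch`, integrability on the lines, line independence and growth of `invFourierLine Θ_θ^arch b` -/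

/-- `γ'` is complex differentiable at every `s` with `Re s > 0` (`γ` is holomorphic on the open right half-plane). -/
theorem differentiableAt_deriv_xiGammaFactor {s : ℂ} (hs : 0 < s.re) :
    DifferentiableAt ℂ (deriv xiGammaFactor) s := by
  have hopen : IsOpen {z : ℂ | 0 < z.re} := isOpen_lt continuous_const Complex.continuous_re
  have hd : DifferentiableOn ℂ xiGammaFactor {z : ℂ | 0 < z.re} := fun z hz =>
    (differentiableAt_xiGammaFactor (Or.inl hz)).differentiableWithinAt
  have han : AnalyticAt ℂ xiGammaFactor s := hd.analyticAt (hopen.mem_nhds hs)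
  exact han.deriv.differentiableAt

/-- `Θ_θ^arch` is complex differentiable at every `z` with `Im z > ½` (`γ(½ − iz) ≠ 0` there: `Re(½ − iz) > 1`). -/
theorem differentiableAt_limThetaArch (θ : ℝ) {z : ℂ} (hz : 1 / 2 < z.im) :
    DifferentiableAt ℂ (limThetaArch θ) z := by
  have hre : 1 < ((1 : ℂ) / 2 - I * z).re := by rw [re_half_sub_I_mul]; linarith
  have hre0 : 0 < ((1 : ℂ) / 2 - I * z).re := by linarith
  have hs1 : ((1 : ℂ) / 2 - I * z) ≠ 1 := fun h => by rw [h] at hre; simp at hre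
  have hγ : xiGammaFactor (1 / 2 - I * z) ≠ 0 := xiGammaFactor_ne_zero hre0 hs1
  have haff : DifferentiableAt ℂ (fun w : ℂ => (1 : ℂ) / 2 - I * w) z := by fun_prop
  have h1 : DifferentiableAt ℂ (deriv xiGammaFactor ∘ fun w : ℂ => (1 : ℂ) / 2 - I * w) z :=
    (differentiableAt_deriv_xiGammaFactor hre0).comp z haff
  have h2 : DifferentiableAt ℂ (xiGammaFactor ∘ fun w : ℂ => (1 : ℂ) / 2 - I * w) z :=
    (differentiableAt_xiGammaFactor (Or.inl hre0)).comp z haff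
  unfold limThetaArch
  exact ((h1.div h2 hγ).const_mul _).cexp

/-- `Θ_θ^arch` is holomorphic on the open half-plane `Im z > ½`. -/
theorem differentiableOn_limThetaArch (θ : ℝ) :
    DifferentiableOn ℂ (limThetaArch θ) {z : ℂ | 1 / 2 < z.im} :=
  fun _ hz => (differentiableAt_limThetaArch θ hz).differentiableWithinAt

/-- `u ↦ Θ_θ^arch(u + ib)` is continuous for `b > ½`. -/
theorem continuous_limThetaArch_line (θ : ℝ) {b : ℝ} (hb : 1 / 2 < b) :
    Continuous fun u : ℝ => limThetaArch θ ((u : ℂ) + (b : ℂ) * I) :=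
  (differentiableOn_limThetaArch θ).continuousOn.comp_continuous
    (by fun_prop : Continuous fun u : ℝ => (u : ℂ) + (b : ℂ) * I) fun u => by simpa using hb

/-- `‖e^{−i(u+ib)x}‖ = e^{bx}` (private copy of the tree's `SuzukiDoor.norm_cexp_line`, to keep the imports light). -/
private theorem norm_cexp_neg_I_line (b x u : ℝ) :
    ‖Complex.exp (-I * ((u : ℂ) + (b : ℂ) * I) * (x : ℂ))‖ = Real.exp (b * x) := by
  rw [Complex.norm_exp]
  congr 1
  simp only [Complex.mul_re, Complex.mul_im, Complex.neg_re, Complex.neg_im, Complex.add_re,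
    Complex.add_im, Complex.I_re, Complex.I_im, Complex.ofReal_re, Complex.ofReal_im]
  ring

/-- The majorant `(1 + |u|)^{−θ}` is integrable on `ℝ` for `θ > 1`. -/
theorem integrable_one_add_abs_rpow_neg {θ : ℝ} (hθ : 1 < θ) :
    Integrable fun u : ℝ => (1 + |u|) ^ (-θ) := by
  have h := integrable_one_add_norm (E := ℝ) (μ := volume) (r := θ) (by simpa using hθ)
  simpa [Real.norm_eq_abs] using h

/-- For `θ > 1` and `b > ½`, the archimedean symbol is integrable along `Im z = b`. -/
theorem integrable_limThetaArch_line {θ : ℝ} (hθ : 1 < θ) {b : ℝ} (hb : 1 / 2 < b) :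
    Integrable fun u : ℝ => limThetaArch θ ((u : ℂ) + (b : ℂ) * I) := by
  obtain ⟨C, _, hC⟩ := norm_limThetaArch_line_le (θ := θ) (by linarith) hb
  refine ((integrable_one_add_abs_rpow_neg hθ).const_mul C).mono'
    (continuous_limThetaArch_line θ hb).aestronglyMeasurable (Eventually.of_forall fun u => ?_)
  exact hC b le_rfl u

/-- The inverse-Fourier integrand `Θ_θ^arch(u+ib) e^{−i(u+ib)x}` is integrable in `u` (`θ > 1`, `b > ½`). -/
theorem integrable_limThetaArch_lineIntegrand {θ : ℝ} (hθ : 1 < θ) {b : ℝ} (hb : 1 / 2 < b) (x : ℝ) :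
    Integrable fun u : ℝ => limThetaArch θ ((u : ℂ) + (b : ℂ) * I) *
      Complex.exp (-I * ((u : ℂ) + (b : ℂ) * I) * (x : ℂ)) := by
  have hI := integrable_limThetaArch_line hθ hb
  refine (hI.norm.mul_const (Real.exp (b * x))).mono' ?_ (Eventually.of_forall fun u => ?_)
  · exact hI.1.mul (by fun_prop : Continuous fun u : ℝ =>
      Complex.exp (-I * ((u : ℂ) + (b : ℂ) * I) * (x : ℂ))).aestronglyMeasurable
  · rw [norm_mul, norm_cexp_neg_I_line]

/-- **Line independence** (RH-free): for `θ > 1` the inverse Fourier transform of `Θ_θ^arch` along `Im z = b`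
does not depend on `b > ½` (Cauchy's theorem on rectangles; the vertical sides vanish by the uniform decay of §2). -/
theorem invFourierLine_limThetaArch_eq {θ : ℝ} (hθ : 1 < θ) {b₁ b₂ : ℝ} (hb₁ : 1 / 2 < b₁) (hb₂ : 1 / 2 < b₂)
    (x : ℝ) : invFourierLine (limThetaArch θ) b₁ x = invFourierLine (limThetaArch θ) b₂ x := by
  wlog hle : b₁ ≤ b₂ generalizing b₁ b₂
  · exact (this hb₂ hb₁ (le_of_not_ge hle)).symm
  unfold invFourierLine
  congr 1
  set b₀ := min b₁ b₂ with hb₀def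
  have hb₀ : 1 / 2 < b₀ := lt_min hb₁ hb₂
  obtain ⟨C, hC0, hC⟩ := norm_limThetaArch_line_le (θ := θ) (by linarith) hb₀
  set g : ℂ → ℂ := fun z => limThetaArch θ z * Complex.exp (-I * z * (x : ℂ)) with hg
  have hga : (fun u : ℝ => g ((u : ℂ) + (b₁ : ℂ) * I)) = fun u : ℝ =>
      limThetaArch θ ((u : ℂ) + (b₁ : ℂ) * I) * Complex.exp (-I * ((u : ℂ) + (b₁ : ℂ) * I) * (x : ℂ)) := rfl
  have hgb : (fun u : ℝ => g ((u : ℂ) + (b₂ : ℂ) * I)) = fun u : ℝ =>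
      limThetaArch θ ((u : ℂ) + (b₂ : ℂ) * I) * Complex.exp (-I * ((u : ℂ) + (b₂ : ℂ) * I) * (x : ℂ)) := rfl
  have key := integral_line_eq_of_differentiableOn_strip (g := g) hle ?_ ?_ ?_
    (h := fun R => C * (1 + R) ^ (-θ) * Real.exp (max (b₁ * x) (b₂ * x))) ?_ ?_
  · simpa [hg] using key
  · intro z hz
    have hz' : 1 / 2 < z.im := by linarith [hz.1]
    exact ((differentiableAt_limThetaArch θ hz').mul (by fun_prop)).differentiableWithinAt
  · rw [hga]; exact integrable_limThetaArch_lineIntegrand hθ hb₁ x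
  · rw [hgb]; exact integrable_limThetaArch_lineIntegrand hθ hb₂ x
  · intro R y hy
    have hyb : b₀ ≤ y := le_trans (min_le_left _ _) hy.1
    have h1 := hC y hyb R
    have h2 : ‖Complex.exp (-I * ((R : ℂ) + (y : ℂ) * I) * (x : ℂ))‖ ≤ Real.exp (max (b₁ * x) (b₂ * x)) := by
      rw [norm_cexp_neg_I_line, Real.exp_le_exp]
      rcases le_or_gt 0 x with hx | hx
      · exact le_trans (mul_le_mul_of_nonneg_right hy.2 hx) (le_max_right _ _)
      · exact le_trans (mul_le_mul_of_nonpos_right hy.1 hx.le) (le_max_left _ _)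
    calc ‖g ((R : ℂ) + (y : ℂ) * I)‖
        = ‖limThetaArch θ ((R : ℂ) + (y : ℂ) * I)‖ *
            ‖Complex.exp (-I * ((R : ℂ) + (y : ℂ) * I) * (x : ℂ))‖ := by
          rw [hg]; exact norm_mul _ _
      _ ≤ C * (1 + |R|) ^ (-θ) * Real.exp (max (b₁ * x) (b₂ * x)) :=
          mul_le_mul h1 h2 (norm_nonneg _) (by positivity)
  · have h1 : Tendsto (fun R : ℝ => (1 + R) ^ (-θ)) atTop (𝓝 0) :=
      (tendsto_rpow_neg_atTop (by linarith : 0 < θ)).comp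
        (tendsto_atTop_add_const_left atTop 1 tendsto_id)
    have := (h1.const_mul C).mul_const (Real.exp (max (b₁ * x) (b₂ * x)))
    simpa using this

/-- Uniform growth of the line transforms (RH-free): for `θ > 1`, `b₀ > ½` there is `D ≥ 0` with
`‖invFourierLine Θ_θ^arch b x‖ ≤ D e^{bx}` for all `b ≥ b₀` and all real `x`. -/
theorem norm_invFourierLine_limThetaArch_le {θ : ℝ} (hθ : 1 < θ) {b₀ : ℝ} (hb₀ : 1 / 2 < b₀) :
    ∃ D : ℝ, 0 ≤ D ∧ ∀ b : ℝ, b₀ ≤ b → ∀ x : ℝ,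
      ‖invFourierLine (limThetaArch θ) b x‖ ≤ D * Real.exp (b * x) := by
  obtain ⟨C, hC0, hC⟩ := norm_limThetaArch_line_le (θ := θ) (by linarith) hb₀
  set M : ℝ := ∫ u : ℝ, (1 + |u|) ^ (-θ) with hM
  refine ⟨1 / (2 * Real.pi) * (C * M), by positivity, fun b hb x => ?_⟩
  have hint : ∫ u : ℝ, ‖limThetaArch θ ((u : ℂ) + (b : ℂ) * I)‖ ≤ C * M := by
    rw [hM, ← integral_const_mul]
    refine integral_mono_of_nonneg (Eventually.of_forall fun u => norm_nonneg _)
      ((integrable_one_add_abs_rpow_neg hθ).const_mul C) (Eventually.of_forall fun u => hC b hb u)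
  calc ‖invFourierLine (limThetaArch θ) b x‖
      ≤ 1 / (2 * Real.pi) * Real.exp (b * x) * ∫ u : ℝ, ‖limThetaArch θ ((u : ℂ) + (b : ℂ) * I)‖ :=
        norm_invFourierLine_le _ _ _
    _ ≤ 1 / (2 * Real.pi) * Real.exp (b * x) * (C * M) := by gcongr
    _ = 1 / (2 * Real.pi) * (C * M) * Real.exp (b * x) := by ring

/-! ## §4 `g_θ = 0` on `(−∞, 0)`; continuity and growth of `g_θ` -/

/-- **Paley–Wiener vanishing** (RH-free): for `θ > 1`, `b > ½` and `x < 0`, `invFourierLine Θ_θ^arch b x = 0`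
(move the line to `Im z = b' → ∞`; the value is `O(e^{b'x}) → 0`). -/
theorem invFourierLine_limThetaArch_eq_zero_of_neg {θ : ℝ} (hθ : 1 < θ) {b : ℝ} (hb : 1 / 2 < b) {x : ℝ}
    (hx : x < 0) : invFourierLine (limThetaArch θ) b x = 0 := by
  obtain ⟨D, hD0, hD⟩ := norm_invFourierLine_limThetaArch_le hθ hb
  set V := invFourierLine (limThetaArch θ) b x with hV
  have hbound : ∀ b' : ℝ, b ≤ b' → ‖V‖ ≤ D * Real.exp (b' * x) := by
    intro b' hb'
    rw [hV, invFourierLine_limThetaArch_eq (b₂ := b') hθ hb (by linarith) x]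
    exact hD b' hb' x
  have hlim : Tendsto (fun b' : ℝ => D * Real.exp (b' * x)) atTop (𝓝 0) := by
    have h1 : Tendsto (fun b' : ℝ => b' * x) atTop atBot := tendsto_id.atTop_mul_const_of_neg hx
    have := (Real.tendsto_exp_atBot.comp h1).const_mul D
    simpa using this
  have hle : ‖V‖ ≤ 0 :=
    ge_of_tendsto hlim (Filter.eventually_atTop.2 ⟨b, fun b' hb' => hbound b' hb'⟩)
  exact norm_le_zero_iff.1 hle

/-- **`g_θ = 0` on `(−∞, 0)`** (RH-free; [Su20] §3): for `θ > 1` and `x < 0`, `limArchKernel θ x = 0`. -/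
theorem limArchKernel_eq_zero_of_neg {θ : ℝ} (hθ : 1 < θ) {x : ℝ} (hx : x < 0) : limArchKernel θ x = 0 := by
  show (invFourierLine (limThetaArch θ) 1 x).re = 0
  rw [invFourierLine_limThetaArch_eq_zero_of_neg hθ (by norm_num) hx, Complex.zero_re]

/-- **Continuity of `g_θ`** (RH-free): for `θ > 1`, `limArchKernel θ` is continuous (dominated convergence on the
line `Im z = 1`, tree: `continuous_invFourierLine`). -/
theorem continuous_limArchKernel {θ : ℝ} (hθ : 1 < θ) : Continuous (limArchKernel θ) := by
  have h : Continuous fun x : ℝ => invFourierLine (limThetaArch θ) 1 x :=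
    continuous_invFourierLine zero_le_one (fun x => by
      simpa using integrable_limThetaArch_lineIntegrand hθ (b := 1) (by norm_num) x)
  exact Complex.continuous_re.comp h

/-- **Growth of `g_θ`** (RH-free): for `θ > 1` and every `b > ½` there is `D ≥ 0` with `|g_θ(x)| ≤ D e^{bx}` for all
real `x`. -/
theorem abs_limArchKernel_le {θ : ℝ} (hθ : 1 < θ) {b : ℝ} (hb : 1 / 2 < b) :
    ∃ D : ℝ, 0 ≤ D ∧ ∀ x : ℝ, |limArchKernel θ x| ≤ D * Real.exp (b * x) := by
  obtain ⟨D, hD0, hD⟩ := norm_invFourierLine_limThetaArch_le hθ hb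
  refine ⟨D, hD0, fun x => ?_⟩
  calc |limArchKernel θ x| = |(invFourierLine (limThetaArch θ) 1 x).re| := rfl
    _ ≤ ‖invFourierLine (limThetaArch θ) 1 x‖ := Complex.abs_re_le_norm _
    _ = ‖invFourierLine (limThetaArch θ) b x‖ := by
        rw [invFourierLine_limThetaArch_eq hθ (by norm_num) hb]
    _ ≤ D * Real.exp (b * x) := hD b le_rfl x

end Summit.RiemannHypothesis.RiemannHypothesis.Theorems.SuzukiWindowsDoorArchKernel

end
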